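import Summits.BirchSwinnertonDyer.Rank1Residual.ManinAdditive.UDCKummerLine
import HarnessLib
import HarnessLib.Audit.Tags

/-!
# The UDC line, analytic node: the C3 LEAD's v23 WITNESS LAW cut into typed pieces (cell bsd-f2-manin, -an g38, MEMO-an §81)
# (nothing asserted beyond the proved composition; T-an-44)

TYPER NOTE (typer g20, T-an-44).  SOURCE = HOME/an/g38/UDCKummerWitnessLine-an-g38.lean sha16 d69c9f2f9468a99d (279 l., written 15:32Z;
an's ask of 15:30Z names the 2-minutes-older text c29d6e8758d564e7, kept by an as `…-an-g38.v1.lean`; v2 = v1 + (WL♭)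
`KummerCubeRootModularFormWitnessNearCusp` — the hypothesis type, VERBATIM, of the C3 LEAD's LANDED glue
`Summit…Theorems.ManinLocalTwoThree.UDCGlue.kummerCubeRootCongruenceOfBoundedOfUDC_of_modularFormWitness_of_lt_im` (p729478,
`Theorems/ManinLocalTwoThreeQExpansionExtension.lean`) — with (QEX) split into (QEXN) `IntegralQSeriesNearCusp` + (QXP)
`QExpansionExtensionPrinciple` (= the type of the LEAD's `QExpansionExtension.hasSum_exp_of_hasSum_of_lt_im`, p729478, up to binder order)
and the `1`-periodicity clause of (EXT) dropped; since landed bodies are immutable the typer lands an's CURRENT text) VERBATIM except this note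
and the attribute `@[conjecture]` on the two research nodes (WL) `KummerCubeRootModularFormWitness` / (WL♭) `KummerCubeRootModularFormWitnessNearCusp`
(their docstrings carry an's kind tag «[conjecture: this programme]»; bodies untouched; the cell's census keys on the attribute).  The four objects
(`minimalY`, `minimalParam`, `kummerMinBlock`, `kummerPoleKiller`) are real defs with bodies; the seven pieces (INT) (ALG) (DICT) (EXT) (QEXN) (QXP) (INV)
are plain `def … : Prop` (an: theorems on paper, engines in the tree by name — (INT) = the first clauses of p3's `MinimalCubeRoot.exists_int_minimalCubeRoot`
p728452, (QXP) = LEAD's p729478; the typer has NOT re-audited the truth of (ALG)/(DICT)/(EXT)/(QEXN)/(INV) — refuter ask R-an-74 pending at landing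
time); the three theorems are pure logic (an: farm rc 0 · 0 err · 0 warn · 0 s∗rry on v1; BC7 7/7 CLEAN on v1 09665396a7815770, v2: g38-bc7-wl.out
3952a48f4827dc51 9/9 CLEAN; typer: own farm check of THIS text rc 0 · 0 warnings, 10.2 s).  Cite keys checked present in references.bib (DiamondShurman2005,
ShimuraIATAF1971; module refs CalegariDimitrovTang2025, Honda1968, SilvermanAEC2009, KurthLong2008).  No instances, no notation; imports the
landed `…ManinAdditive.UDCKummerLine` (p725103) only — route-independent, Theses-free cone.  PARTITION 3 · beyond-print theorem: no ·
bears_on stmt-BirchSwinnertonDyer-22968 (C3, node (AN♮)/(WL) of LEAD's v23/v24) · BSD is not proved by this; (WL), (WL♭), C3 OPEN.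

Context.  `UDCKummerLine.lean` typed the UDC line for the reducible residual of C3 (`ManinLocalTwoThree.ManinPrimeToThreeAtNine`):
(NC) ∧ (BI) ∧ (AN) ⇒ `ReducibleCaseAtNine`, (AN) ⇐ (AN♮) `KummerCubeRootCongruenceOfBoundedOfUDC := (∀ k, UnboundedDenominatorsWeight k) → KummerCubeRootCongruenceOfBounded`.
(BI), (NC-a), (NC-b) at `9 ∣ N`, KL08 Prop. 18 and `(CDT, ℤ-version) ⇒ ∀ k, UnboundedDenominatorsWeight k` are THEOREMS
(`kummerCubeRoot_threeAdicallyBounded`, `kummerCoverSubgroup_holds`, `KummerCover.exists_mem_gamma1_not_kummerPeriodTrivial`,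
`KurthLong2008_prop18_typeII_noncongruence`, `UDWOfCDT.unboundedDenominatorsWeight_of_CDT`), and the C3 LEAD's registered skeleton v23 reduces (AN♮) to
ONE content stub, the WITNESS LAW `stub_kummerCubeRootModularFormWitness` (glue `kummerCubeRootCongruenceOfBoundedOfUDC_of_modularFormWitness`, p727487;
audited CLEAN AS TYPED, ref1 §R170): from the data of (AN) produce a weight `k` and a holomorphic `F : ℍ → ℂ` whose `Γ₀(N)`-stabiliser under `∣[k]` is
EXACTLY the Kummer condition `KummerPeriodTrivial D u ·`, of exponential growth at every cusp, with an INTEGER `q`-expansion converging on `ℍ`.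
This file states that law as the named Prop `KummerCubeRootModularFormWitness` (the stub's type VERBATIM), its RELAXED form
`KummerCubeRootModularFormWitnessNearCusp` (integer `q`-series only for `Im τ > B` — the C3 LEAD's v24 shape, justified by his
`QExpansionExtension.hasSum_exp_of_hasSum_of_lt_im`, p729478, here the by-name piece (QXP)), and PROVES
`kummerCubeRootModularFormWitnessNearCusp_of_pieces : (INT) → (ALG) → (DICT) → (EXT) → (QEXN) → (INV) → …NearCusp` and
`kummerCubeRootModularFormWitness_of_pieces : … → (QXP) → KummerCubeRootModularFormWitness`
from typed pieces, each a theorem on paper whose engine is already in the tree (by name below).  The witness is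

  `F = κ·(t_W∘φ)·W_{u,e}(c·ℰ_f)·(Δ^{deg P}·P(j))ⁿ`,   `t_W = −x_W/y_W` (MINIMAL model), `W_{u,e} = sigmaCubeRoot`, `e = m₁η₁ + m₂η₂` (`3u = m₁ω₁ + m₂ω₂`),

where `P ∈ ℤ[X] ∖ 0` vanishes at the `j`-values of the pole set `B = φ⁻¹{y_W = 0} ∩ ℍ` and `n` is large.  WHY THE MINIMAL MODEL (p3 2026-08-29T15:24:30Z,
MEMO-an §80.12 (5), ref1 §R166 R1/R2): the short-model cube root `h` has UNBOUNDED `2`-power denominators (27a1: `2⁸` by `q²⁵`); its minimal-model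
renormalisation `g = ρ⁻¹h`, `c·z·g = z_W·h`, is INTEGRAL (`MinimalCubeRoot.exists_int_minimalCubeRoot`, p728452, `D = 1`), and analytically
`ρ⁻¹·(t_s·W) = (1/c)·t_W·W` (p3), so the block `kummerMinBlock := (t_W∘φ)·W(c·ℰ_f)` below is `c·ρ⁻¹∘φ` times p2's block `shortT·sigmaCubeRoot` whose
`Γ₀(N)`-multiplier is the Kummer character (`KummerCubeRootDictionary.exists_multiplier_gamma`, `forall_gamma_smul_eq_of_kummerPeriodTrivial`,
`kummerPeriodTrivial_of_forall_gamma_smul_eq`, p728257); `t_W∘φ` is `Γ₀(N)`-invariant.  WHY `P(j)` WITH `P ∈ ℤ[X]`: the poles of the block lie on `B`,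
finitely many `Γ₀(N)`-orbits with ALGEBRAIC `j`-values (`B = φ⁻¹` of the `≤ 3` algebraic points `y_W = 0`; `Aut(ℂ)`-transport makes `j(B)` Galois-stable),
so a nonzero INTEGER polynomial `P` kills them and `(Δ^{deg P}P(j))ⁿ = (Σᵢ pᵢE₄^{3i}Δ^{deg P − i})ⁿ` is a level-one form of weight `12·n·deg P` with INTEGER
`q`-expansion (`E₄, Δ ∈ ℤ⟦q⟧`: tree `E₄_qExpansion_coeff_int`, `discriminant_qExpansion_coeff_int`) — this keeps the witness inside the ℤ-version of
Unbounded Denominators that the LEAD's `stub_CDT` names (`Literature.NumberTheory.Automorphic.CalegariDimitrovTang2025_unboundedDenominators`).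

The pieces (ranked by content; (INT) and (QXP) are CLOSED by name, (INV) is p2's AN2-c plus the level-one factor, (QEXN) is generic `q`-series
bookkeeping near the cusp; (ALG), (DICT), (EXT) carry the remaining analysis):
* (INT)  `MinimalKummerCubeRootIntegral` — `∃ g ∈ ℤ⟦q⟧`, `g(0) = −1`, `c·(z·g) = z_W·h` (= the first three clauses of `MinimalCubeRoot.exists_int_minimalCubeRoot`);
* (ALG)  `KummerPoleValuesAlgebraic` — `∃ P ∈ ℤ[X] ∖ 0` with `P(j(τ)) = 0` whenever `c·ℰ(τ) ∉ Λ` and `y_W(φ τ) = 0` (finite fibres of `φ : X₀(N) → W` over the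
  algebraic points `y_W = 0`: tree `modularFunctionField`, `pointValuation_xFn_sub_lt_one`; `Aut(ℂ)`-transport `transport_weierstrassP_values`,
  `exists_isTransportedBy`, `IsTransportedBy.j_eq`; integrality test `Complex.isIntegral_of_forall_ringEquiv_mem`; clear denominators to land in `ℤ[X]`);
* (DICT) `KummerMinimalDictionary` — high in the cusp `c·ℰ(τ) ∉ Λ`, `y_W(φ τ) ≠ 0` and `Σ gₙqⁿ = κ·kummerMinBlock` for a constant `κ ≠ 0` (p2's AN2-a/b
  `KummerCubeRootDictionary.exists_hasSum_const_mul_shortT_mul_sigmaCubeRoot` for `h ↔ κ'·t_s·W`, times the dictionary `z_W/(c z) ↔ t_W/(c t_s)` for `ρ⁻¹`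
  (`ShortGermTransport.shortGerm_mul_eq'`, S1 internals `z ↔ t_s`, `z_W ↔ t_W`); uniqueness of holomorphic lifts `eq_of_pow_eq_of_constantCoeff_eq`);
* (EXT)  `KummerMinimalWitnessExtension` — for `P` killing `j(B)` and any constant `C₀` there are `n` and a holomorphic `F : ℍ → ℂ` equal to
  `C₀·kummerMinBlock·kummerPoleKiller P n` off `B ∪ φ⁻¹(O)` and of exponential growth at every cusp in weight `12·n·deg P` (removable singularities: the block is
  regular on `φ⁻¹(O)` — simple zero of `t_W` against simple pole of `W` — and has poles of order `≤ 3·e_τ(c·ℰ)` on `B`, bounded in terms of `D`; `P(j)` vanishes on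
  `B`; at a cusp `g·i∞` the block is `Φ̃(c·ℰ(gτ))` with `Φ̃` meromorphic on `ℂ` and `ℰ∘g` a `q_w`-series, so `|block(gτ)| ≤ C·|q_w|^{−m}` uniformly in `Re τ`;
  templates `PeriodLatticePresentationProofs.exists_invariant_extension`, `LevelOneAnnihilatorProofs`);
* (QEXN) `IntegralQSeriesNearCusp` — GENERIC: if `Φ = Σ gₘq^m` for `Im τ > B` with `g ∈ ℤ⟦q⟧` and `F = Φ·kummerPoleKiller P n` for `Im τ > B'`, then
  `F = Σ bₘ e^{2πiτm}` with `b : ℕ → ℤ` for `Im τ` large (Cauchy product with the INTEGER `q`-series of `(Δ^{deg P}P(j))ⁿ`: tree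
  `KummerCubeQExpansion.hasSum_coeff_mul_pow_mul`, `E₄_qExpansion_coeff_int`, `discriminant_qExpansion_coeff_int`, Mathlib `ModularFormClass.hasSum_qExpansion`);
* (QXP)  `QExpansionExtensionPrinciple` — GENERIC, CLOSED BY NAME (C3 LEAD `QExpansionExtension.hasSum_exp_of_hasSum_of_lt_im`, p729478): a holomorphic
  `f : ℍ → ℂ` given by a `q`-series for `Im τ > B` is given by it on all of `ℍ`;
* (INV)  `KummerMinimalWitnessInvariance` — for such an `F` (`C₀ ≠ 0`, `P ≠ 0`) and `γ ∈ Γ₀(N)`: `KummerPeriodTrivial D u γ ⟺ F ∣[12·n·deg P] γ = F` (p2's AN2-c for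
  the block, `(Δ^{deg P}P(j))ⁿ` level one of that weight, identity theorem off the discrete set `B ∪ φ⁻¹(O)`; `⟸` uses `F ≢ 0`: block `→ κ·σ(−u) ≠ 0` and
  killer `→ (lead coeff P)ⁿ ≠ 0` at `i∞`).
The composition is pure logic (`m₁, m₂` from `3u ∈ Λ` by `Submodule.mem_span_pair`); `hopt` (lattice optimality) is not used by any piece — it enters
the UDC line only through (NC-a).  Truth audit (planner): every piece is true as typed, including the degenerate instances (`P = 0` in (EXT)/(QEXN): take
`n = 1`, `F = 0`, `b = 0`; arbitrary `C₀` in (EXT)); (INV) needs `P ≠ 0 ∧ C₀ ≠ 0` and has them.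

PARTITION 3 (certificate, beyond print as a typed statement: yes — printed engines CDT25 Thm. 1.0.1, Honda 1968 Thm. 5, Shimura 1971 §2/§6, KL08 Prop. 18;
BSD is not proved by this; C3 stays OPEN until the pieces close).  No `sorry`, no new axioms; `instance`/`notation` free (typer lint); imports the
ManinAdditive statement layer only (no `Theorems`, no `Literature.NumberTheory.Automorphic`: CDT enters in the LEAD's skeleton, not here).

References: [CalegariDimitrovTang2025] F. Calegari, V. Dimitrov, Y. Tang, *The unbounded denominators conjecture*, JAMS 38 (2025), Thm. 1.0.1 (arXiv:2109.09040);
[Honda1968] Thm. 5; [SilvermanAEC2009] IV.1 (`z = −x/y`), VI.3 (`σ`), VII.3.4; [ShimuraIATAF1971] §2.4–2.6, §6.2; [DiamondShurman2005] §1.2 (`E₄, Δ ∈ ℤ⟦q⟧`),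
§3.2, §11.1; [KurthLong2008] Prop. 18; cell: MEMO-an §80.12–§81, ref1 §R166/§R170, p3 STATUS 2026-08-29T15:24:30Z, C3 LEAD skeleton v23.
-/

set_option autoImplicit false

noncomputable section

open PowerSeries CongruenceSubgroup Complex
open scoped MatrixGroups ModularForm PeriodPair UpperHalfPlane Manifold
open WeierstrassCurve Literature.NumberTheory.EllipticCurves Literature.NumberTheory.EllipticCurves.ModularForms
open Summit.BirchSwinnertonDyer.Rank1Residual.ManinAdditive.CuspidalKummer
open Summit.BirchSwinnertonDyer.Rank1Residual.ManinAdditive.CuspidalKummerThree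
open Summit.BirchSwinnertonDyer.Rank1Residual.ManinAdditive.KummerCubeMonodromy
open Summit.BirchSwinnertonDyer.Rank1Residual.ManinAdditive.UDCKummerLine

namespace Summit.BirchSwinnertonDyer.Rank1Residual.ManinAdditive.UDCKummerWitnessLine

variable {W : WeierstrassCurve ℚ} {N : ℕ} [NeZero N]

/-! ## §1 The objects: the minimal-model block and the integer pole killer -/

/-- `c³·(y_W∘φ)(τ) = y_s − (a₁c/2)(x_s − c²b₂/12) − c³a₃/2` in terms of the short-model coordinates `x_s = c²℘(cℰ)`, `y_s = c³℘′(cℰ)/2`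
(`x_s = c²(x_W + b₂/12)`, `y_s = c³(y_W + (a₁x_W + a₃)/2)`); its zero set off `φ⁻¹(O)` is the pole set `B = φ⁻¹{y_W = 0}`. [folklore] -/
def minimalY (D : ModularParametrizationData W N) (τ : ℍ) : ℂ :=
  shortY D τ - (W.a₁ : ℂ) * (D.c : ℂ) / 2 * (shortX D τ - (D.c : ℂ) ^ 2 * (W.b₂ : ℂ) / 12) - (D.c : ℂ) ^ 3 * (W.a₃ : ℂ) / 2

/-- `t_W∘φ = (−x_W/y_W)∘φ = −c·(x_s − c²b₂/12)/(c³·y_W∘φ)`, the formal parameter of the MINIMAL model along the parametrisation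
(`c`-free as a function on `W`; junk `0` on `B`). [folklore] -/
def minimalParam (D : ModularParametrizationData W N) (τ : ℍ) : ℂ :=
  -((D.c : ℂ) * (shortX D τ - (D.c : ℂ) ^ 2 * (W.b₂ : ℂ) / 12)) / minimalY D τ

/-- **The minimal Kummer block** `(t_W∘φ)(τ)·W_{u,e}(c·ℰ_f(τ))` (`= c·(ρ⁻¹∘φ)·(t_s·W)`, p3): regular on `φ⁻¹(O)`, poles on `B`, `Γ₀(N)`-multiplier
= the Kummer character of `W_{u,e}`; junk values on `B ∪ φ⁻¹(O)`. [folklore] -/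
def kummerMinBlock (D : ModularParametrizationData W N) (u e : ℂ) (τ : ℍ) : ℂ :=
  minimalParam D τ * sigmaCubeRoot D.L u e ((D.c : ℂ) * eichlerIntegral D.f τ)

/-- **The integer pole killer** `(Δ^{deg P}·P(j))ⁿ = (Σ_{i ≤ deg P} pᵢ·E₄^{3i}·Δ^{deg P − i})ⁿ` (`j = E₄³/Δ`): a level-one modular form of weight
`12·n·deg P` with INTEGER `q`-expansion, vanishing to order `≥ n` wherever `P(j) = 0`, `≢ 0` iff `P ≠ 0` (or `n = 0`).
[cite: DiamondShurman2005, §1.2 and §3.2] -/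
def kummerPoleKiller (P : Polynomial ℤ) (n : ℕ) (τ : ℍ) : ℂ :=
  (∑ i ∈ Finset.range (P.natDegree + 1),
      ((P.coeff i : ℤ) : ℂ) * ModularForm.E₄ τ ^ (3 * i) * ModularForm.discriminant τ ^ (P.natDegree - i)) ^ n

/-! ## §2 The witness law (the C3 LEAD's v23 `stub_kummerCubeRootModularFormWitness`, VERBATIM) -/

/-- **(WL) the Kummer witness law** — the type of the C3 LEAD's registered stub `stub_kummerCubeRootModularFormWitness` (skeleton v23), verbatim:
from the data of (AN) a weight `k` and a holomorphic `F : ℍ → ℂ` whose `Γ₀(N)`-stabiliser is exactly `KummerPeriodTrivial D u ·`, of exponential growth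
at the cusps, with an integer `q`-expansion on `ℍ`.  With the landed glue, CDT (ℤ-version), NC-a/b and KL08 it yields (AN) and `ReducibleCaseAtNine`.
[conjecture: this programme — MEMO-an §80.12/§81, skeleton v23] -/
@[conjecture]
def KummerCubeRootModularFormWitness : Prop :=
  ∀ (W : WeierstrassCurve ℚ) [W.IsElliptic] [W.IsGloballyMinimal] {N : ℕ} [NeZero N]
    (D : ModularParametrizationData W N) (a : ℕ → ℤ), (∀ n, (a n : ℂ) = cuspCoeff D.f n) →
    (∀ z ∈ D.L.lattice, ∃ w ∈ periodLattice D.f, z = D.c * w) →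
    ∀ X₀ Y₀ : ℚ, IsShortThreeTorsion W D.c X₀ Y₀ →
    ∀ u : ℂ, u ∉ D.L.lattice → 3 * u ∈ D.L.lattice →
      (D.c : ℂ) ^ 2 * D.L.weierstrassP u = (X₀ : ℂ) → (D.c : ℂ) ^ 3 * D.L.derivWeierstrassP u / 2 = (Y₀ : ℂ) →
    ∀ z : ℚ⟦X⟧, IsParamGerm W D.c a z →
    ∀ h : ℚ⟦X⟧, h ^ 3 = kummerCubeSeries W D.c X₀ Y₀ z → PowerSeries.constantCoeff h = -1 → IsThreeAdicallyBounded h →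
      ∃ (k : ℤ) (F : ℍ → ℂ), MDifferentiable 𝓘(ℂ) 𝓘(ℂ) F ∧
        (∀ γ : Gamma0 N, KummerPeriodTrivial D u γ → F ∣[k] (γ : SL(2, ℤ)) = F) ∧
        (∀ γ : Gamma0 N, F ∣[k] (γ : SL(2, ℤ)) = F → KummerPeriodTrivial D u γ) ∧
        (∀ g : SL(2, ℤ), ∃ C A m : ℝ, ∀ τ : ℍ, A ≤ τ.im → ‖(F ∣[k] g) τ‖ ≤ C * Real.exp (m * τ.im)) ∧
        (∃ b : ℕ → ℤ, ∀ τ : ℍ, HasSum (fun n : ℕ ↦ (b n : ℂ) * Complex.exp (2 * Real.pi * Complex.I * (τ : ℂ) * n)) (F τ))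

/-- **(WL♭) the RELAXED witness law** (C3 LEAD v24 shape; the hypothesis type of his `UDCGlue.kummerCubeRootCongruenceOfBoundedOfUDC_of_modularFormWitness_of_lt_im`,
p729478, VERBATIM): as (WL) but the integer `q`-series is required only for `Im τ > B`.  (WL♭) ∧ (QXP) ⟹ (WL) below. [conjecture: this programme — skeleton v24] -/
@[conjecture]
def KummerCubeRootModularFormWitnessNearCusp : Prop :=
  ∀ (W : WeierstrassCurve ℚ) [W.IsElliptic] [W.IsGloballyMinimal] {N : ℕ} [NeZero N]
    (D : ModularParametrizationData W N) (a : ℕ → ℤ), (∀ n, (a n : ℂ) = cuspCoeff D.f n) →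
    (∀ z ∈ D.L.lattice, ∃ w ∈ periodLattice D.f, z = D.c * w) →
    ∀ X₀ Y₀ : ℚ, IsShortThreeTorsion W D.c X₀ Y₀ →
    ∀ u : ℂ, u ∉ D.L.lattice → 3 * u ∈ D.L.lattice →
      (D.c : ℂ) ^ 2 * D.L.weierstrassP u = (X₀ : ℂ) → (D.c : ℂ) ^ 3 * D.L.derivWeierstrassP u / 2 = (Y₀ : ℂ) →
    ∀ z : ℚ⟦X⟧, IsParamGerm W D.c a z →
    ∀ h : ℚ⟦X⟧, h ^ 3 = kummerCubeSeries W D.c X₀ Y₀ z → PowerSeries.constantCoeff h = -1 → IsThreeAdicallyBounded h →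
      ∃ (k : ℤ) (F : ℍ → ℂ), MDifferentiable 𝓘(ℂ) 𝓘(ℂ) F ∧
        (∀ γ : Gamma0 N, KummerPeriodTrivial D u γ → F ∣[k] (γ : SL(2, ℤ)) = F) ∧
        (∀ γ : Gamma0 N, F ∣[k] (γ : SL(2, ℤ)) = F → KummerPeriodTrivial D u γ) ∧
        (∀ g : SL(2, ℤ), ∃ C A m : ℝ, ∀ τ : ℍ, A ≤ τ.im → ‖(F ∣[k] g) τ‖ ≤ C * Real.exp (m * τ.im)) ∧
        (∃ (b : ℕ → ℤ) (B : ℝ), ∀ τ : ℍ, B < τ.im →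
          HasSum (fun n : ℕ ↦ (b n : ℂ) * Complex.exp (2 * Real.pi * Complex.I * (τ : ℂ) * n)) (F τ))

/-! ## §3 The pieces -/

/-- **(INT) the minimal-model cube root is integral**: there is `g ∈ ℤ⟦q⟧` with `g(0) = −1` and `c·(z·g) = z_W·h`, `z_W = exp_W(c·Σaₙqⁿ/n)` the germ of the
minimal model.  CLOSED BY NAME: the first three clauses of `MinimalCubeRoot.exists_int_minimalCubeRoot` (p728452; Honda at every prime, global
Nagell–Lutz for `T`, cube roots `p`-integral for `p ≠ 3`, (BI) + UFD at `p = 3`). [folklore] -/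
def MinimalKummerCubeRootIntegral : Prop :=
  ∀ (W : WeierstrassCurve ℚ) [W.IsElliptic] [W.IsGloballyMinimal] {N : ℕ} [NeZero N]
    (D : ModularParametrizationData W N) (a : ℕ → ℤ), (∀ n, (a n : ℂ) = cuspCoeff D.f n) →
    ∀ X₀ Y₀ : ℚ, IsShortThreeTorsion W D.c X₀ Y₀ →
    ∀ z : ℚ⟦X⟧, IsParamGerm W D.c a z →
    ∀ h : ℚ⟦X⟧, h ^ 3 = kummerCubeSeries W D.c X₀ Y₀ z → constantCoeff h = -1 → IsThreeAdicallyBounded h →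
      ∃ g : ℚ⟦X⟧, (∀ n, (coeff n g).den = 1) ∧ constantCoeff g = -1 ∧
        (D.c : ℚ) • (z * g) = W.formalExp.subst ((D.c : ℚ) • lSeriesLog a) * h

/-- **(ALG) the pole set has algebraic `j`-values, killed by one integer polynomial**: some `P ∈ ℤ[X] ∖ 0` vanishes at `j(τ) = E₄³/Δ` for every `τ` with
`c·ℰ(τ) ∉ Λ` and `(y_W∘φ)(τ) = 0` (`B = φ⁻¹{y_W = 0}`: finitely many `Γ₀(N)`-orbits over `≤ 3` algebraic points; `Aut(ℂ)`-transport ⇒ `j(B)` Galois-stable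
⇒ product of cleared minimal polynomials). [cite: ShimuraIATAF1971, §6.2 (algebraic values of modular functions at algebraic points of the curve) and §2.4] -/
def KummerPoleValuesAlgebraic : Prop :=
  ∀ (W : WeierstrassCurve ℚ) [W.IsElliptic] [W.IsGloballyMinimal] {N : ℕ} [NeZero N] (D : ModularParametrizationData W N),
    ∃ P : Polynomial ℤ, P ≠ 0 ∧
      ∀ τ : ℍ, (D.c : ℂ) * eichlerIntegral D.f τ ∉ D.L.lattice → minimalY D τ = 0 →
        P.eval₂ (Int.castRingHom ℂ) (ModularForm.E₄ τ ^ 3 / ModularForm.discriminant τ) = 0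

/-- **(DICT) formal ↔ analytic dictionary for the minimal cube root**: for `g` with `c·(z·g) = z_W·h`, high in the cusp one is off `B ∪ φ⁻¹(O)` and
`Σ gₙ qⁿ = κ·(t_W∘φ)·W_{u,e}(c·ℰ)` for a constant `κ ≠ 0` (`e = m₁η₁ + m₂η₂`).  Engines: p2 `KummerCubeRootDictionary.exists_hasSum_const_mul_shortT_mul_sigmaCubeRoot`
(`h ↔ κ'·t_s·W`), the `ρ⁻¹` dictionary `z_W/(cz) ↔ t_W/(c·t_s)` (S1 internals, `ShortGermTransport`), `eq_of_pow_eq_of_constantCoeff_eq`. [folklore] -/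
def KummerMinimalDictionary : Prop :=
  ∀ (W : WeierstrassCurve ℚ) [W.IsElliptic] [W.IsGloballyMinimal] {N : ℕ} [NeZero N]
    (D : ModularParametrizationData W N) (a : ℕ → ℤ), (∀ n, (a n : ℂ) = cuspCoeff D.f n) →
    ∀ X₀ Y₀ : ℚ, IsShortThreeTorsion W D.c X₀ Y₀ →
    ∀ u : ℂ, u ∉ D.L.lattice → ∀ m₁ m₂ : ℤ, 3 * u = m₁ * D.L.ω₁ + m₂ * D.L.ω₂ →
      (D.c : ℂ) ^ 2 * ℘[D.L] u = (X₀ : ℂ) → (D.c : ℂ) ^ 3 * ℘'[D.L] u / 2 = (Y₀ : ℂ) →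
    ∀ z : ℚ⟦X⟧, IsParamGerm W D.c a z →
    ∀ h : ℚ⟦X⟧, h ^ 3 = kummerCubeSeries W D.c X₀ Y₀ z → constantCoeff h = -1 →
    ∀ g : ℚ⟦X⟧, (D.c : ℚ) • (z * g) = W.formalExp.subst ((D.c : ℚ) • lSeriesLog a) * h →
      ∃ κ : ℂ, κ ≠ 0 ∧ ∃ B : ℝ, ∀ τ : ℍ, B < τ.im →
        (D.c : ℂ) * eichlerIntegral D.f τ ∉ D.L.lattice ∧ minimalY D τ ≠ 0 ∧
        HasSum (fun n : ℕ ↦ ((coeff n g : ℚ) : ℂ) * Function.Periodic.qParam 1 (τ : ℂ) ^ n)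
          (κ * kummerMinBlock D u (m₁ * D.L.η₁ + m₂ * D.L.η₂) τ)

/-- **(EXT) holomorphic extension with exponential growth**: for `P ∈ ℤ[X]` vanishing at `j(B)` and any constant `C₀`, some power `n` makes
`C₀·kummerMinBlock·kummerPoleKiller P n` extend from the complement of `B ∪ φ⁻¹(O)` to a holomorphic `F` on `ℍ` with
`‖(F ∣[12·n·deg P] g)(τ)‖ ≤ C·e^{m·Im τ}` high in every cusp (removable singularities; block regular on `φ⁻¹(O)`, pole order on `B` bounded by `3·e_τ(c·ℰ)`;
cusp growth from `ℰ∘g` = `q_w`-series and `Φ̃` meromorphic). [folklore] -/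
def KummerMinimalWitnessExtension : Prop :=
  ∀ (W : WeierstrassCurve ℚ) [W.IsElliptic] [W.IsGloballyMinimal] {N : ℕ} [NeZero N] (D : ModularParametrizationData W N),
    ∀ u : ℂ, u ∉ D.L.lattice → ∀ m₁ m₂ : ℤ, 3 * u = m₁ * D.L.ω₁ + m₂ * D.L.ω₂ →
    ∀ P : Polynomial ℤ,
      (∀ τ : ℍ, (D.c : ℂ) * eichlerIntegral D.f τ ∉ D.L.lattice → minimalY D τ = 0 →
        P.eval₂ (Int.castRingHom ℂ) (ModularForm.E₄ τ ^ 3 / ModularForm.discriminant τ) = 0) →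
    ∀ C₀ : ℂ, ∃ (n : ℕ) (F : ℍ → ℂ), MDifferentiable 𝓘(ℂ) 𝓘(ℂ) F ∧
      (∀ τ : ℍ, (D.c : ℂ) * eichlerIntegral D.f τ ∉ D.L.lattice → minimalY D τ ≠ 0 →
        F τ = C₀ * kummerMinBlock D u (m₁ * D.L.η₁ + m₂ * D.L.η₂) τ * kummerPoleKiller P n τ) ∧
      (∀ g : SL(2, ℤ), ∃ C A m : ℝ, ∀ τ : ℍ, A ≤ τ.im →
        ‖(F ∣[((12 * n * P.natDegree : ℕ) : ℤ)] g) τ‖ ≤ C * Real.exp (m * τ.im))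

/-- **(QEXN) integer `q`-series of the witness near the cusp (GENERIC bookkeeping)**: if `Φ = Σ gₘq^m` for `Im τ > B` with `g ∈ ℤ⟦q⟧` and
`F = Φ·kummerPoleKiller P n` for `Im τ > B'`, then `F = Σ bₘe^{2πiτm}` with INTEGER `bₘ` for `Im τ` large (Cauchy product with the integer `q`-series of
`(Δ^{deg P}P(j))ⁿ`; `E₄, Δ ∈ ℤ⟦q⟧`). [folklore] -/
def IntegralQSeriesNearCusp : Prop :=
  ∀ (Φ F : ℍ → ℂ) (g : ℚ⟦X⟧) (P : Polynomial ℤ) (n : ℕ),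
    (∀ m, (coeff m g).den = 1) →
    (∃ B : ℝ, ∀ τ : ℍ, B < τ.im → HasSum (fun m : ℕ ↦ ((coeff m g : ℚ) : ℂ) * Function.Periodic.qParam 1 (τ : ℂ) ^ m) (Φ τ)) →
    (∃ B : ℝ, ∀ τ : ℍ, B < τ.im → F τ = Φ τ * kummerPoleKiller P n τ) →
      ∃ (b : ℕ → ℤ) (B : ℝ), ∀ τ : ℍ, B < τ.im →
        HasSum (fun m : ℕ ↦ (b m : ℂ) * Complex.exp (2 * Real.pi * Complex.I * (τ : ℂ) * m)) (F τ)

/-- **(QXP) `q`-expansion extension principle (GENERIC; CLOSED BY NAME)**: a holomorphic `f : ℍ → ℂ` given by a `q`-series for `Im τ > B` is given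
by the same series on all of `ℍ` — the C3 LEAD's `QExpansionExtension.hasSum_exp_of_hasSum_of_lt_im` (p729478: periodicity by the identity theorem,
boundedness at `i∞`, Mathlib `UpperHalfPlane.hasSum_qExpansion`, uniqueness of the cusp-function power series). [folklore] -/
def QExpansionExtensionPrinciple : Prop :=
  ∀ (f : ℍ → ℂ), MDifferentiable 𝓘(ℂ) 𝓘(ℂ) f → ∀ (b : ℕ → ℂ) (B : ℝ),
    (∀ τ : ℍ, B < τ.im → HasSum (fun n : ℕ ↦ b n * Complex.exp (2 * Real.pi * Complex.I * (τ : ℂ) * n)) (f τ)) →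
    ∀ τ : ℍ, HasSum (fun n : ℕ ↦ b n * Complex.exp (2 * Real.pi * Complex.I * (τ : ℂ) * n)) (f τ)

/-- **(INV) the stabiliser of the witness is the Kummer group**: for `P ≠ 0`, `C₀ ≠ 0` and a holomorphic `F` equal to `C₀·kummerMinBlock·kummerPoleKiller P n`
off `B ∪ φ⁻¹(O)`, and `γ ∈ Γ₀(N)`: `KummerPeriodTrivial D u γ ⟺ F ∣[12·n·deg P] γ = F` (`t_W∘φ` is `Γ₀(N)`-invariant, `W(w + ω_γ) = ρ_γW(w)` with `ρ_γ = 1 ⟺`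
Kummer — p2 `KummerCubeRootDictionary.exists_multiplier_gamma` / p3 `KummerCover.sigmaCubeRoot_periodic_iff` —, the killer is level one of that weight, identity
theorem across the discrete set `B ∪ φ⁻¹(O)`; `⟸` uses `F ≢ 0`). [folklore] -/
def KummerMinimalWitnessInvariance : Prop :=
  ∀ (W : WeierstrassCurve ℚ) [W.IsElliptic] [W.IsGloballyMinimal] {N : ℕ} [NeZero N] (D : ModularParametrizationData W N),
    ∀ u : ℂ, u ∉ D.L.lattice → ∀ m₁ m₂ : ℤ, 3 * u = m₁ * D.L.ω₁ + m₂ * D.L.ω₂ →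
    ∀ P : Polynomial ℤ, P ≠ 0 → ∀ (n : ℕ) (C₀ : ℂ), C₀ ≠ 0 →
    ∀ F : ℍ → ℂ, MDifferentiable 𝓘(ℂ) 𝓘(ℂ) F →
      (∀ τ : ℍ, (D.c : ℂ) * eichlerIntegral D.f τ ∉ D.L.lattice → minimalY D τ ≠ 0 →
        F τ = C₀ * kummerMinBlock D u (m₁ * D.L.η₁ + m₂ * D.L.η₂) τ * kummerPoleKiller P n τ) →
      ∀ γ : Gamma0 N,
        (KummerPeriodTrivial D u γ → F ∣[((12 * n * P.natDegree : ℕ) : ℤ)] (γ : SL(2, ℤ)) = F) ∧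
        (F ∣[((12 * n * P.natDegree : ℕ) : ℤ)] (γ : SL(2, ℤ)) = F → KummerPeriodTrivial D u γ)

/-! ## §4 The compositions (pure logic) -/

/-- **(INT) → (ALG) → (DICT) → (EXT) → (QEXN) → (INV) → (WL♭)**: the witness is `F = κ·kummerMinBlock·kummerPoleKiller P n` in weight `12·n·deg P`. -/
theorem kummerCubeRootModularFormWitnessNearCusp_of_pieces
    (hINT : MinimalKummerCubeRootIntegral) (hALG : KummerPoleValuesAlgebraic) (hDICT : KummerMinimalDictionary)
    (hEXT : KummerMinimalWitnessExtension) (hQEXN : IntegralQSeriesNearCusp) (hINV : KummerMinimalWitnessInvariance) :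
    KummerCubeRootModularFormWitnessNearCusp := by
  intro W _ _ N _ D a ha _hopt X₀ Y₀ hT u hu h3u hX hY z hz h hh hh0 hbd
  obtain ⟨g, hgint, _hg0, hgrel⟩ := hINT W D a ha X₀ Y₀ hT z hz h hh hh0 hbd
  obtain ⟨P, hP0, hPB⟩ := hALG W D
  have h3u' : 3 * u ∈ Submodule.span ℤ {D.L.ω₁, D.L.ω₂} := h3u
  obtain ⟨m₁, m₂, hm⟩ := Submodule.mem_span_pair.mp h3u'
  have hm' : 3 * u = m₁ * D.L.ω₁ + m₂ * D.L.ω₂ := by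
    rw [← hm, zsmul_eq_mul, zsmul_eq_mul]
  obtain ⟨κ, hκ, B, hB⟩ := hDICT W D a ha X₀ Y₀ hT u hu m₁ m₂ hm' hX hY z hz h hh hh0 g hgrel
  obtain ⟨n, F, hFd, hFeq, hFgr⟩ := hEXT W D u hu m₁ m₂ hm' P hPB κ
  refine ⟨((12 * n * P.natDegree : ℕ) : ℤ), F, hFd, fun γ hγ ↦ (hINV W D u hu m₁ m₂ hm' P hP0 n κ hκ F hFd hFeq γ).1 hγ,
    fun γ hγ ↦ (hINV W D u hu m₁ m₂ hm' P hP0 n κ hκ F hFd hFeq γ).2 hγ, hFgr, ?_⟩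
  exact hQEXN (fun τ ↦ κ * kummerMinBlock D u (m₁ * D.L.η₁ + m₂ * D.L.η₂) τ) F g P n hgint
    ⟨B, fun τ hτ ↦ (hB τ hτ).2.2⟩ ⟨B, fun τ hτ ↦ hFeq τ (hB τ hτ).1 (hB τ hτ).2.1⟩

/-- **(WL♭) → (QXP) → (WL)**: the integer `q`-series extends from `Im τ > B` to `ℍ`. -/
theorem kummerCubeRootModularFormWitness_of_nearCusp (hNear : KummerCubeRootModularFormWitnessNearCusp)
    (hQXP : QExpansionExtensionPrinciple) : KummerCubeRootModularFormWitness := by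
  intro W _ _ N _ D a ha hopt X₀ Y₀ hT u hu h3u hX hY z hz h hh hh0 hbd
  obtain ⟨k, F, hFd, h1, h2, h3, b, B, hbB⟩ := hNear W D a ha hopt X₀ Y₀ hT u hu h3u hX hY z hz h hh hh0 hbd
  exact ⟨k, F, hFd, h1, h2, h3, b, hQXP F hFd (fun n ↦ (b n : ℂ)) B hbB⟩

/-- **(INT) → (ALG) → (DICT) → (EXT) → (QEXN) → (INV) → (QXP) → (WL)** (v23 `stub_kummerCubeRootModularFormWitness`). -/
theorem kummerCubeRootModularFormWitness_of_pieces
    (hINT : MinimalKummerCubeRootIntegral) (hALG : KummerPoleValuesAlgebraic) (hDICT : KummerMinimalDictionary)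
    (hEXT : KummerMinimalWitnessExtension) (hQEXN : IntegralQSeriesNearCusp) (hINV : KummerMinimalWitnessInvariance)
    (hQXP : QExpansionExtensionPrinciple) : KummerCubeRootModularFormWitness :=
  kummerCubeRootModularFormWitness_of_nearCusp
    (kummerCubeRootModularFormWitnessNearCusp_of_pieces hINT hALG hDICT hEXT hQEXN hINV) hQXP

end Summit.BirchSwinnertonDyer.Rank1Residual.ManinAdditive.UDCKummerWitnessLine

end
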